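import Summits.HodgeConjecture.HodgeConjecture.Theorems.R90S6EtaOneGraphPartner     -- ★ W10-a (E.4) `etaOneGraphPartnerAlgHom` (p06) = print's `η̂₁` in graph currency (brings the U(2) Satake estate)
import Summits.HodgeConjecture.HodgeConjecture.Theorems.R90S6BCPartnerOnGenerators   -- ★ W10-c (G.0)–(G.3) `glHeckeEigencharacter_bcLine_heckeDiag_one∕two∕three` (p06)
import Literature.NumberTheory.Automorphic.GLnSphericalHeckeAlgebraStructure         -- ★ `algHom_heckeAlgebra_glInt_ext_of_commRing` (characters determined on the `c_{(1^r)}`)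
import HarnessLib

/-!
# R90 · S6 «Ch. 14.1–14.5 stable TF» — WAVE 10 card W10-h: THE TWISTED-ENDOSCOPIC PARTNER `η̂₁` ON THE GENERATORS `T₁, T₂, T₃^{±1}` OF
# `ℋ(GL₃(K), GL₃(𝒪))`, and «`η̂₁` IS DETERMINED BY THEM» (`Theorems/R90S6EtaOnePartnerOnGenerators.lean`; DAG r5 rows E1.4.4.1.2 ∕ E1.4.4.3.x, coefficient layer)

Cell `hodgecm-mathlib`, crux H413 (`stmt-HodgeConjecture-24833`), route of record `HCCMUnconditional`; programme R90-TF, section S6 (base `R90-C14`),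
seat R90-C14-p02 (g2); S6 dealer R90-C14-plan (g2) CARD W10-h (R90 bus 2026-09-05T00:47Z «η̂₁-PARTNER ON GENERATORS» = the endoscopic twin of ★ W10-c
`R90S6BCPartnerOnGenerators` (p06) over ★ W10-a `etaOneGraphPartnerAlgHom` (p06)).  Lane `--supports stmt-HodgeConjecture-24833 --as helper`; THEOREMS ONLY
(no definition, no instance, no notation, no named fact, no `sorry`); letters = ★ p09∕p06's `Partner` section VERBATIM (generic DVR field `K`, `hϖ`, `hu : u² = #𝓀[K]`,
`hwt` = the unitary `δ^{1∕2}` normalisation at `n = 3`); imports = ★ Theorems + ★ `GLnSphericalHeckeAlgebraStructure` + HarnessLib (no `Cruxes` import).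

(N.0) THE GRAPH LETTER OF ★ W10-a (census): `graph_etaOneGraphPartnerAlgHom : λ^{GL₃}_{![z,1,z⁻¹]}(φ) = unitaryHeckeEigencharacterAdic c hc1 v w hw hv ![z,1] (η̂₁ φ)` —
`GL₃`-side parameter = FILE D's `rogawskiParamBC z = (z, 1, z⁻¹)` (the parameter of `χ_z ∘ N`, print §4.10 p. 58), `U(J₀,2)(E_w)`-side parameter `![z, 1]` = D's
`rogawskiParamH z` (`χ_z(d(a, ā⁻¹)) = z^{val a}`); UNSIGNED (ruling R1: print's `η̂₁`, §4.7 p. 48 case `a ≢ b`, `η₁(w) = 1 × w` — no `μ` on the spherical line; `complexConj`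
enters only through the inert place `w` and `σ_w`); both sides `δ^{1∕2}`-normalised (`hwt` ∕ ★ `unitaryHeckeEigencharacterAdic`).  On this line ★ (G.1)–(G.3):
`λ^{GL₃}(T₁) = λ^{GL₃}(T₂) = q_K·(z + 1 + z⁻¹)`, `λ^{GL₃}(T₃) = 1` (`q_K = #𝓀[K]`; at the junction `K = E_w`, `q_K = Q = q_v²`).
CONTENT (`T_r := heckeAlgebra.doubleCosetOperator (glInt 3 K) (heckeDiag 3 ϖ r)`, `η̂₁ :=` ★ `etaOneGraphPartnerAlgHom`, characterised by ★ `eq_etaOneGraphPartnerAlgHom_of_graph`):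
* (N.1) **`η̂₁ T₁ = q_K • T₁ᵁ + q_K • 1`** for the NORMALISED `U(J₀,2)` generator `T₁ᵁ` (`𝒮_w(T₁ᵁ) = x^{(1,−1)} + x^{(−1,1)}`, `λ_{(z,1)}(T₁ᵁ) = z + z⁻¹`; inhabited by ★
  `exists_generator_unitaryHeckeAlgebraAdic_two`, which also says `ℋ(U(J₀,2)(E_w), K₀) = ℂ[T₁ᵁ]`): both sides of the graph equal `q_K(z + 1 + z⁻¹)`.
  Kill-check `z = 1`: `3 q_K = q_K·2 + q_K` ✓.
* (N.1′) **`η̂₁ T₁ = √Q • φ′₁ + √Q • 1`** in the RAW letters of the junction `K = L_w`: `φ′₁ = 1_{K₀ t K₀}`, `t = diag(ϖ′, ϖ′⁻¹)`, the basic operator of ★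
  `heckeEigencharacter_doubleCosetOperator_basic_two` (`λ_{(z,1)}(φ′₁) = √Q(z + z⁻¹) + √Q − 1`, `Q = #𝓀[E_w]`, `√Q = Nat.sqrt Q`), under the junction identities
  `hqQ : (#𝓀[K] : ℂ) = #𝓀[E_w]` (★ `natCard_residueField_eq_of_compatible` at `K = L_w`) and `hQ : (√Q)² = Q` (`Q = q_v²` at an inert place, ★
  `fintypeCard_valuedResidueField_eq_sq_of_inert`): `√Q(√Q(z+z⁻¹) + √Q − 1) + √Q = Q(z + 1 + z⁻¹)` ✓ (kill-check `z = 1`: `√Q(3√Q − 1) + √Q = 3Q` ✓).  Unlike the rank-3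
  twin (B.1′) (`b T₁ = φ₁ + (Q − √Q + 1)•1`), the `U(2)` basic operator carries the factor `√Q = q_v`, whence `hQ`.
* (N.2) **`η̂₁ T₂ = η̂₁ T₁`** ((G.1) = (G.2): `η̂₁` is far from injective, `ℂ[e₁, e₂, e₃^{±1}] ↠ ℂ[z + z⁻¹]`).
* (N.3) **`η̂₁ T₃ = 1`**, (N.3′) **`η̂₁ T₃⁻¹ = 1`** (no central `μ`-twist on the UNSIGNED graph: `e₃(z,1,z⁻¹) = 1`; the `μ`-signed composite is the (E.6) corollary's business).
* (N.4) **`η̂₁` IS DETERMINED BY (N.1)–(N.3)**: any `ℂ`-algebra map `χ : ℋ(GL₃(K), GL₃(𝒪)) →ₐ[ℂ] ℋ(U(J₀,2)(E_w), K₀)` agreeing with `η̂₁` on `T₁, T₂, T₃` IS `η̂₁`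
  (★ `algHom_heckeAlgebra_glInt_ext_of_commRing` — the `c_{(1^r)} = T_r` and `T₃⁻¹` generate, the value on `T₃⁻¹` is forced — + ★ `zpowDiagGL_indicator_le_eq_heckeDiag`).
PROOF HYGIENE as ★ W10-c: the `U(2)` side by the explicit `RingHom`∕`LinearMap` laws of the eigencharacter, the first `GL₃` rewrite applied as a TERM.

HONEST LABEL: local spherical Hecke bookkeeping; proves no printed global statement and NOT the fundamental lemma Prop. 4.10.1 (b) for `η̂₁` (E1.4.4.5b socket);
count-neutral until E1.4.4.3.x (the coefficients of `η̂₁(φ_λ)`) consumes it.  HC_CM is proved only modulo the 7 printed citations (2 remaining named inputs: hLiu418 =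
stmt-HodgeConjecture-24832, h413 = stmt-HodgeConjecture-24833) until rung 0 closes; REL ≠ ★ ≠ BUILT.

## References
* [Rogawski1990] J. D. Rogawski, *Automorphic Representations of Unitary Groups in Three Variables*, Ann. of Math. Stud. 123 (1990), §4.7 p. 48 (`η₁`, case `a ≢ b`),
  §4.10 Prop. 4.10.1 (b), Prop. 4.10.2 pp. 57–58 (`Tr(π̃(φ)π̃(ε)) = Tr(i_H(χ)(η̂₁ φ))`; print fixes no explicit value of `η̂₁(T_r)`).
* [ShimuraIATAF1971] G. Shimura, *Introduction to the arithmetic theory of automorphic functions* (1971), Thm. 3.20, Thm. 3.21 (`ω(T_r)`).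
* [CartierCorvallis1979] P. Cartier, *Representations of 𝔭-adic groups: a survey*, PSPM 33.1 (1979), §IV (4.2)–(4.4), Cor. 4.2.
* [Macdonald1995] I. G. Macdonald, *Symmetric Functions and Hall Polynomials* (2nd ed. 1995), Ch. V (2.5), §3 (3.2) (characters of `ℋ(GL_n)` through the `c_{(1^r)}`).
-/

set_option autoImplicit false
-- the mandated namespace repeats the single-problem summit's segment (`HodgeConjecture.HodgeConjecture`)
set_option linter.dupNamespace false

noncomputable section

open NumberField IsDedekindDomain Polynomial
open Literature.NumberTheory.Automorphic Literature.NumberTheory.Automorphic.HermitianLattice Literature.NumberTheory.Automorphic.UnitaryGroup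
open Literature.NumberTheory.Automorphic.CartanUnique
open scoped MatrixGroups
open ValuativeRel Finset

namespace Summit.HodgeConjecture.HodgeConjecture.R90.S6

universe u

/-- Pure algebra: an algebra homomorphism that sends `x` to `1` sends any right inverse `y` of `x` to `1`. [folklore] -/
private theorem map_eq_one_of_mul_eq_one' {A B : Type*} [Semiring A] [Semiring B] [Algebra ℂ A] [Algebra ℂ B] (f : A →ₐ[ℂ] B)
    {x y : A} (hxy : x * y = 1) (hx : f x = 1) : f y = 1 :=
  calc f y = f x * f y := by rw [hx, one_mul]
    _ = f (x * y) := (map_mul f x y).symm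
    _ = 1 := by rw [hxy, map_one]

section Partner

variable {F E : Type} [Field F] [NumberField F] [Field E] [NumberField E] [Algebra F E] [Algebra.IsQuadraticExtension F E]
  (c : E ≃ₐ[F] E) (hc1 : c ≠ 1) (v : HeightOneSpectrum (𝓞 F)) (w : PlacesOver E v) (hw : c • w.1 = w.1)
  (hv : Algebra.IsUnramifiedIn (𝓞 E) v.asIdeal)
  {K : Type u} [Field K] [ValuativeRel K] [IsDiscreteValuationRing 𝒪[K]] [Finite 𝓀[K]] {ϖ : K}
  [IsHeckeTriple (⊤ : Submonoid (GL (Fin 3) K)) (glInt 3 K) (glInt 3 K)]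
  (hϖ : IsUniformizingElement ϖ) {u : ℂˣ} (hu : (u : ℂ) ^ 2 = ((Nat.card 𝓀[K] : ℕ) : ℂ))
  {wt : Multiplicative (Fin 3 → ℤ) →* ℂ}
  (hwt : ∀ e : Fin 3 → ℤ, wt (Multiplicative.ofAdd e) = ((u ^ ((((3 : ℕ) : ℤ) - 1) * (∑ i, e i) - 2 * satakeTwistExp e) : ℂˣ) : ℂ))

/-! ## §1 (N.1) `η̂₁ T₁` in normalised letters -/

/-- **(N.1) `η̂₁ T₁ = q_K • T₁ᵁ + q_K • 1`** for the normalised `U(J₀,2)` generator `T₁ᵁ` (`𝒮_w(T₁ᵁ) = x^{(1,−1)} + x^{(−1,1)}`, so `λ_{(z,1)}(T₁ᵁ) = z + z⁻¹`; inhabited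
by ★ `exists_generator_unitaryHeckeAlgebraAdic_two`): both sides of the graph `λ^{GL₃}_{(z,1,z⁻¹)}(T₁) = λ^{U(2)}_{(z,1)}(·)` equal `q_K(z + 1 + z⁻¹)` (★ (G.1)
`glHeckeEigencharacter_bcLine_heckeDiag_one` ∕ ★ `unitaryHeckeEigencharacterAdic_two_aeval`), and the partner is unique (★ `eq_etaOneGraphPartnerAlgHom_of_graph`).
`q_K = #𝓀[K]` is the `GL₃`-side residue cardinality; no `U(2)`-side constant enters. [cite: Rogawski1990, §4.10 Prop. 4.10.2 p. 58] [cite: CartierCorvallis1979, §IV Cor. 4.2] -/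
theorem etaOneGraphPartnerAlgHom_heckeDiag_one
    {T₁ : heckeAlgebra ℂ ↥(unitaryGroupOfForm (galAdicCompletionMap (L := E) c hw) ((StdForm.antidiagonal 2).over (w.1.adicCompletion E)))
      (unitaryInt (galAdicCompletionMap (L := E) c hw) ((StdForm.antidiagonal 2).over (w.1.adicCompletion E)))}
    (hT₁ : unitarySatakeTransformAdic c hc1 v w hw hv T₁ =
      AddMonoidAlgebra.single (fun i : Fin 2 => (1 : ℤ) * (1 - 2 * (i : ℕ))) (1 : ℂ) +
        AddMonoidAlgebra.single (fun i : Fin 2 => (-1 : ℤ) * (1 - 2 * (i : ℕ))) 1) :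
    etaOneGraphPartnerAlgHom c hc1 v w hw hv hϖ hu hwt
        (heckeAlgebra.doubleCosetOperator (glInt 3 K) (heckeDiag 3 (Units.mk0 ϖ hϖ.ne_zero) 1)) =
      ((Nat.card 𝓀[K] : ℕ) : ℂ) • T₁ + ((Nat.card 𝓀[K] : ℕ) : ℂ) • 1 := by
  refine (eq_etaOneGraphPartnerAlgHom_of_graph c hc1 v w hw hv hϖ hu hwt _ _ fun z => ?_).symm
  have hT : unitaryHeckeEigencharacterAdic c hc1 v w hw hv ![z, 1] T₁ = (z : ℂ) + (z : ℂ)⁻¹ := by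
    have h := unitaryHeckeEigencharacterAdic_two_aeval c hc1 v w hw hv hT₁ X z
    rwa [aeval_X, eval_X] at h
  have hs : ∀ x, unitaryHeckeEigencharacterAdic c hc1 v w hw hv ![z, 1] (((Nat.card 𝓀[K] : ℕ) : ℂ) • x) =
      ((Nat.card 𝓀[K] : ℕ) : ℂ) • unitaryHeckeEigencharacterAdic c hc1 v w hw hv ![z, 1] x :=
    fun x => (unitaryHeckeEigencharacterAdic c hc1 v w hw hv ![z, 1]).toLinearMap.map_smul _ x
  have hadd := (unitaryHeckeEigencharacterAdic c hc1 v w hw hv ![z, 1]).toRingHom.map_add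
    (((Nat.card 𝓀[K] : ℕ) : ℂ) • T₁) (((Nat.card 𝓀[K] : ℕ) : ℂ) • 1)
  have hone := (unitaryHeckeEigencharacterAdic c hc1 v w hw hv ![z, 1]).toRingHom.map_one
  refine (glHeckeEigencharacter_bcLine_heckeDiag_one hϖ hu hwt z).trans (Eq.trans ?_ (hadd.trans (congrArg₂ (· + ·)
    ((hs T₁).trans (congrArg (((Nat.card 𝓀[K] : ℕ) : ℂ) • ·) hT)) ((hs 1).trans (congrArg (((Nat.card 𝓀[K] : ℕ) : ℂ) • ·) hone)))).symm)
  rw [smul_eq_mul, smul_eq_mul]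
  ring

/-! ## §2 (N.1′) `η̂₁ T₁` in the raw letters of the junction `K = L_w` -/

/-- **(N.1′) `η̂₁ T₁ = √Q • φ′₁ + √Q • 1` in the RAW letters of the junction `K = L_w`**: `φ′₁ = 1_{K₀ t K₀}` the basic `U(J₀,2)` operator of ★
`heckeEigencharacter_doubleCosetOperator_basic_two` (`λ_{(z,1)}(φ′₁) = √Q(z + z⁻¹) + √Q − 1`, `Q = #𝓀[E_w]`, `√Q = Nat.sqrt Q`, read at `w` through any unramified datum `hd` by ★
`unitaryHeckeEigencharacterAdic_eq`, `σ_w ≠ id` by ★ `exists_galAdicCompletionMap_ne`), under the junction identities `hqQ : (#𝓀[K] : ℂ) = #𝓀[E_w]` (★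
`natCard_residueField_eq_of_compatible` at `K = L_w`) and `hQ : √Q · √Q = Q` (`Q = q_v²` at an inert place, ★ `fintypeCard_valuedResidueField_eq_sq_of_inert` + `Nat.sqrt_eq'`):
then `√Q(√Q(z + z⁻¹) + √Q − 1) + √Q = Q(z + 1 + z⁻¹) = λ^{GL₃}_{(z,1,z⁻¹)}(T₁)`.  This is the form the coefficient layer E1.4.4.3.x cites.
[cite: Rogawski1990, §4.10 Prop. 4.10.2 p. 58] [cite: CartierCorvallis1979, §IV (4.2), Cor. 4.2] -/
theorem etaOneGraphPartnerAlgHom_heckeDiag_one_eq_basic {ϖ' : w.1.adicCompletion E}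
    (hd : UnramifiedLocalConjDatum (galAdicCompletionMap (L := E) c hw) ϖ')
    (hqQ : ((Nat.card 𝓀[K] : ℕ) : ℂ) = (Nat.card (Valued.ResidueField (w.1.adicCompletion E)) : ℂ))
    (hQ : (Nat.sqrt (Nat.card (Valued.ResidueField (w.1.adicCompletion E))) : ℂ) *
        (Nat.sqrt (Nat.card (Valued.ResidueField (w.1.adicCompletion E))) : ℂ) =
      (Nat.card (Valued.ResidueField (w.1.adicCompletion E)) : ℂ)) :
    haveI := isHeckeTriple_unitaryInt_adicCompletion c v w hw ((StdForm.antidiagonal 2).over (w.1.adicCompletion E))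
    etaOneGraphPartnerAlgHom c hc1 v w hw hv hϖ hu hwt
        (heckeAlgebra.doubleCosetOperator (glInt 3 K) (heckeDiag 3 (Units.mk0 ϖ hϖ.ne_zero) 1)) =
      (Nat.sqrt (Nat.card (Valued.ResidueField (w.1.adicCompletion E))) : ℂ) •
          heckeAlgebra.doubleCosetOperator
            (unitaryInt (galAdicCompletionMap (L := E) c hw) ((StdForm.antidiagonal 2).over (w.1.adicCompletion E)))
            (⟨zpowDiagGL (uniformizer_ne_zero hd.vϖ) (fun i : Fin 2 => (1 : ℤ) * (1 - 2 * (i : ℕ))),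
              zpowDiagGL_mem_unitaryGroupOfForm hd.σϖ _ (rev_linear_two 1)⟩ :
              ↥(unitaryGroupOfForm (galAdicCompletionMap (L := E) c hw) ((StdForm.antidiagonal 2).over (w.1.adicCompletion E)))) +
        (Nat.sqrt (Nat.card (Valued.ResidueField (w.1.adicCompletion E))) : ℂ) • 1 := by
  haveI := isHeckeTriple_unitaryInt_adicCompletion c v w hw ((StdForm.antidiagonal 2).over (w.1.adicCompletion E))
  haveI := finite_residueField_adicCompletion E w.1
  refine (eq_etaOneGraphPartnerAlgHom_of_graph c hc1 v w hw hv hϖ hu hwt _ _ fun z => ?_).symm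
  -- `λ_{(z,1)}(φ′₁) = √Q(z + z⁻¹) + √Q − 1` (★ `heckeEigencharacter_doubleCosetOperator_basic_two`, read through any datum `hd`)
  have hφ := (DFunLike.congr_fun (unitaryHeckeEigencharacterAdic_eq c hc1 v w hw hv hd ![z, 1]) _).trans
    (hd.heckeEigencharacter_doubleCosetOperator_basic_two (exists_galAdicCompletionMap_ne c hc1 v w hw) ![z, 1])
  have hz : (((![z, 1] : Fin 2 → ℂˣ) 0 : ℂˣ) : ℂ) * ((((![z, 1] : Fin 2 → ℂˣ) 1 : ℂˣ) : ℂ))⁻¹ = z := by simp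
  rw [hz] at hφ
  have hone := (unitaryHeckeEigencharacterAdic c hc1 v w hw hv ![z, 1]).toRingHom.map_one
  have hs : ∀ (r : ℂ) x, unitaryHeckeEigencharacterAdic c hc1 v w hw hv ![z, 1] (r • x) =
      r • unitaryHeckeEigencharacterAdic c hc1 v w hw hv ![z, 1] x :=
    fun r x => (unitaryHeckeEigencharacterAdic c hc1 v w hw hv ![z, 1]).toLinearMap.map_smul r x
  refine (glHeckeEigencharacter_bcLine_heckeDiag_one hϖ hu hwt z).trans (Eq.trans ?_
    (((unitaryHeckeEigencharacterAdic c hc1 v w hw hv ![z, 1]).toRingHom.map_add _ _).trans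
      (congrArg₂ (· + ·) ((hs _ _).trans (congrArg (_ • ·) hφ)) ((hs _ 1).trans (congrArg (_ • ·) hone)))).symm)
  rw [smul_eq_mul, smul_eq_mul, mul_one, hqQ]
  linear_combination (-((z : ℂ) + (z : ℂ)⁻¹ + 1)) * hQ

/-! ## §3 (N.2), (N.3), (N.3′) -/

/-- **(N.2) `η̂₁ T₂ = η̂₁ T₁`**: `T₁` and `T₂` have the same eigencharacter on the line `(z, 1, z⁻¹)` ((G.1) = (G.2)), hence the same partner.
[cite: Rogawski1990, §4.10 Prop. 4.10.2 p. 58] -/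
theorem etaOneGraphPartnerAlgHom_heckeDiag_two :
    etaOneGraphPartnerAlgHom c hc1 v w hw hv hϖ hu hwt
        (heckeAlgebra.doubleCosetOperator (glInt 3 K) (heckeDiag 3 (Units.mk0 ϖ hϖ.ne_zero) 2)) =
      etaOneGraphPartnerAlgHom c hc1 v w hw hv hϖ hu hwt
        (heckeAlgebra.doubleCosetOperator (glInt 3 K) (heckeDiag 3 (Units.mk0 ϖ hϖ.ne_zero) 1)) :=
  (eq_etaOneGraphPartnerAlgHom_of_graph c hc1 v w hw hv hϖ hu hwt _ _ fun z => by
    rw [glHeckeEigencharacter_bcLine_heckeDiag_two hϖ hu hwt, ← graph_etaOneGraphPartnerAlgHom c hc1 v w hw hv hϖ hu hwt,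
      glHeckeEigencharacter_bcLine_heckeDiag_one hϖ hu hwt]).symm

/-- **(N.3) `η̂₁ T₃ = 1`**: the central operator has eigencharacter `1` on the line ((G.3)) and `λ^{U(2)}(1) = 1`. [cite: Rogawski1990, §4.10 Prop. 4.10.2 p. 58] -/
theorem etaOneGraphPartnerAlgHom_heckeDiag_three :
    etaOneGraphPartnerAlgHom c hc1 v w hw hv hϖ hu hwt
        (heckeAlgebra.doubleCosetOperator (glInt 3 K) (heckeDiag 3 (Units.mk0 ϖ hϖ.ne_zero) 3)) = 1 :=
  (eq_etaOneGraphPartnerAlgHom_of_graph c hc1 v w hw hv hϖ hu hwt _ _ fun z => by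
    rw [glHeckeEigencharacter_bcLine_heckeDiag_three hϖ hu hwt, map_one]).symm

/-- **(N.3′) `η̂₁ T₃⁻¹ = 1`** for the inverse central operator (★ `SatakeGL.doubleCosetOperator_heckeDiag_self_mul_inv`: `T₃ · T₃⁻¹ = 1`, and `η̂₁` is an algebra homomorphism
with `η̂₁ T₃ = 1`). [cite: Rogawski1990, §4.10 Prop. 4.10.2 p. 58] -/
theorem etaOneGraphPartnerAlgHom_heckeDiag_three_inv :
    etaOneGraphPartnerAlgHom c hc1 v w hw hv hϖ hu hwt
        (heckeAlgebra.doubleCosetOperator (glInt 3 K) (heckeDiag 3 (Units.mk0 ϖ hϖ.ne_zero) 3)⁻¹) = 1 :=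
  map_eq_one_of_mul_eq_one' (etaOneGraphPartnerAlgHom c hc1 v w hw hv hϖ hu hwt)
    (SatakeGL.doubleCosetOperator_heckeDiag_self_mul_inv (n := 3) (F := K) hϖ) (etaOneGraphPartnerAlgHom_heckeDiag_three c hc1 v w hw hv hϖ hu hwt)

/-! ## §4 (N.4) `η̂₁` is determined by its values on `T₁, T₂, T₃` -/

/-- **(N.4) `η̂₁` IS DETERMINED BY (N.1)–(N.3)**: a `ℂ`-algebra homomorphism `χ : ℋ(GL₃(K), GL₃(𝒪)) →ₐ[ℂ] ℋ(U(J₀,2)(E_w), K₀)` that agrees with `η̂₁` on the three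
generators `T₁, T₂, T₃` IS `η̂₁` (★ `algHom_heckeAlgebra_glInt_ext_of_commRing`: the `c_{(1^{r+1})} = T_{r+1}` together with `T₃⁻¹` generate and the value on `T₃⁻¹` is forced;
★ `zpowDiagGL_indicator_le_eq_heckeDiag` converts the generator letters; all conversions in term mode — no `rw` on these carriers).
[cite: Macdonald1995, Ch. V (2.5), §3 (3.2)] [cite: ShimuraIATAF1971, Thm. 3.20] -/
theorem etaOneGraphPartnerAlgHom_ext_heckeDiag
    {χ : heckeAlgebra ℂ (GL (Fin 3) K) (glInt 3 K) →ₐ[ℂ]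
      heckeAlgebra ℂ ↥(unitaryGroupOfForm (galAdicCompletionMap (L := E) c hw) ((StdForm.antidiagonal 2).over (w.1.adicCompletion E)))
        (unitaryInt (galAdicCompletionMap (L := E) c hw) ((StdForm.antidiagonal 2).over (w.1.adicCompletion E)))}
    (h1 : χ (heckeAlgebra.doubleCosetOperator (glInt 3 K) (heckeDiag 3 (Units.mk0 ϖ hϖ.ne_zero) 1)) =
      etaOneGraphPartnerAlgHom c hc1 v w hw hv hϖ hu hwt (heckeAlgebra.doubleCosetOperator (glInt 3 K) (heckeDiag 3 (Units.mk0 ϖ hϖ.ne_zero) 1)))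
    (h2 : χ (heckeAlgebra.doubleCosetOperator (glInt 3 K) (heckeDiag 3 (Units.mk0 ϖ hϖ.ne_zero) 2)) =
      etaOneGraphPartnerAlgHom c hc1 v w hw hv hϖ hu hwt (heckeAlgebra.doubleCosetOperator (glInt 3 K) (heckeDiag 3 (Units.mk0 ϖ hϖ.ne_zero) 2)))
    (h3 : χ (heckeAlgebra.doubleCosetOperator (glInt 3 K) (heckeDiag 3 (Units.mk0 ϖ hϖ.ne_zero) 3)) =
      etaOneGraphPartnerAlgHom c hc1 v w hw hv hϖ hu hwt (heckeAlgebra.doubleCosetOperator (glInt 3 K) (heckeDiag 3 (Units.mk0 ϖ hϖ.ne_zero) 3))) :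
    χ = etaOneGraphPartnerAlgHom c hc1 v w hw hv hϖ hu hwt := by
  refine algHom_heckeAlgebra_glInt_ext_of_commRing (χ₁ := χ) (χ₂ := etaOneGraphPartnerAlgHom c hc1 v w hw hv hϖ hu hwt) hϖ fun r => ?_
  have e := zpowDiagGL_indicator_le_eq_heckeDiag (n := 3) hϖ.ne_zero r
  obtain ⟨r, hr⟩ := r
  rcases r with _ | _ | _ | k
  · exact (congrArg (fun g => χ (heckeAlgebra.doubleCosetOperator (glInt 3 K) g)) e).trans
      (h1.trans (congrArg (fun g => etaOneGraphPartnerAlgHom c hc1 v w hw hv hϖ hu hwt (heckeAlgebra.doubleCosetOperator (glInt 3 K) g)) e).symm)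
  · exact (congrArg (fun g => χ (heckeAlgebra.doubleCosetOperator (glInt 3 K) g)) e).trans
      (h2.trans (congrArg (fun g => etaOneGraphPartnerAlgHom c hc1 v w hw hv hϖ hu hwt (heckeAlgebra.doubleCosetOperator (glInt 3 K) g)) e).symm)
  · exact (congrArg (fun g => χ (heckeAlgebra.doubleCosetOperator (glInt 3 K) g)) e).trans
      (h3.trans (congrArg (fun g => etaOneGraphPartnerAlgHom c hc1 v w hw hv hϖ hu hwt (heckeAlgebra.doubleCosetOperator (glInt 3 K) g)) e).symm)
  · exact absurd hr (by omega)

/-- **(N.4′) explicit form**: a `ℂ`-algebra homomorphism `χ` with `χ T₁ = q_K • T₁ᵁ + q_K • 1`, `χ T₂ = χ T₁` and `χ T₃ = 1` IS `η̂₁`.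
[cite: Macdonald1995, Ch. V §3 (3.2)] [cite: Rogawski1990, §4.10 Prop. 4.10.2 p. 58] -/
theorem eq_etaOneGraphPartnerAlgHom_of_heckeDiag
    {T₁ : heckeAlgebra ℂ ↥(unitaryGroupOfForm (galAdicCompletionMap (L := E) c hw) ((StdForm.antidiagonal 2).over (w.1.adicCompletion E)))
      (unitaryInt (galAdicCompletionMap (L := E) c hw) ((StdForm.antidiagonal 2).over (w.1.adicCompletion E)))}
    (hT₁ : unitarySatakeTransformAdic c hc1 v w hw hv T₁ =
      AddMonoidAlgebra.single (fun i : Fin 2 => (1 : ℤ) * (1 - 2 * (i : ℕ))) (1 : ℂ) +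
        AddMonoidAlgebra.single (fun i : Fin 2 => (-1 : ℤ) * (1 - 2 * (i : ℕ))) 1)
    {χ : heckeAlgebra ℂ (GL (Fin 3) K) (glInt 3 K) →ₐ[ℂ]
      heckeAlgebra ℂ ↥(unitaryGroupOfForm (galAdicCompletionMap (L := E) c hw) ((StdForm.antidiagonal 2).over (w.1.adicCompletion E)))
        (unitaryInt (galAdicCompletionMap (L := E) c hw) ((StdForm.antidiagonal 2).over (w.1.adicCompletion E)))}
    (h1 : χ (heckeAlgebra.doubleCosetOperator (glInt 3 K) (heckeDiag 3 (Units.mk0 ϖ hϖ.ne_zero) 1)) =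
      ((Nat.card 𝓀[K] : ℕ) : ℂ) • T₁ + ((Nat.card 𝓀[K] : ℕ) : ℂ) • 1)
    (h2 : χ (heckeAlgebra.doubleCosetOperator (glInt 3 K) (heckeDiag 3 (Units.mk0 ϖ hϖ.ne_zero) 2)) =
      χ (heckeAlgebra.doubleCosetOperator (glInt 3 K) (heckeDiag 3 (Units.mk0 ϖ hϖ.ne_zero) 1)))
    (h3 : χ (heckeAlgebra.doubleCosetOperator (glInt 3 K) (heckeDiag 3 (Units.mk0 ϖ hϖ.ne_zero) 3)) = 1) :
    χ = etaOneGraphPartnerAlgHom c hc1 v w hw hv hϖ hu hwt :=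
  have h1' : χ (heckeAlgebra.doubleCosetOperator (glInt 3 K) (heckeDiag 3 (Units.mk0 ϖ hϖ.ne_zero) 1)) =
      etaOneGraphPartnerAlgHom c hc1 v w hw hv hϖ hu hwt (heckeAlgebra.doubleCosetOperator (glInt 3 K) (heckeDiag 3 (Units.mk0 ϖ hϖ.ne_zero) 1)) :=
    h1.trans (etaOneGraphPartnerAlgHom_heckeDiag_one c hc1 v w hw hv hϖ hu hwt hT₁).symm
  etaOneGraphPartnerAlgHom_ext_heckeDiag c hc1 v w hw hv hϖ hu hwt h1'
    (h2.trans (h1'.trans (etaOneGraphPartnerAlgHom_heckeDiag_two c hc1 v w hw hv hϖ hu hwt).symm))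
    (h3.trans (etaOneGraphPartnerAlgHom_heckeDiag_three c hc1 v w hw hv hϖ hu hwt).symm)

end Partner

end Summit.HodgeConjecture.HodgeConjecture.R90.S6

end
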